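import Literature.AlgebraicGeometry.Motives.VarietiesRegularProofs
import Literature.AlgebraicGeometry.Motives.ProjectiveDescentNormProofs
import Mathlib.AlgebraicGeometry.Noetherian
import HarnessLib

/-!
# Schemes smooth over a regular base are regular (Görtz–Wedhorn I, Lemma 6.26 / Matsumura, Thm. 23.7 (ii))

`Motives/VarietiesRegularProofs` proves that the local rings of a scheme smooth of relative
dimension `n` over a FIELD are regular (`isRegularLocalRing_stalk_of_smoothOfRelativeDimension`):
affine-locally the algebra is étale over a polynomial ring, and étale over regular is regular
(`IsRegularLocalRing.of_etale`, Stacks 00TV). The same printed argument works over any locally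
noetherian base all of whose local rings are regular (The Stacks Project, Tag 036D: "a smooth
morphism `X → S` with `S` regular has `X` regular"; EGA IV₄ 17.5.8 (iii); Matsumura, Thm. 23.7 (ii)
via flatness), and this file records it:

* `isRegularRing_of_isAffineOpen` — on a locally noetherian scheme with regular local rings, the
  ring of sections over an affine open is a regular ring (Mathlib `IsRegularRing`: its localisations
  at primes are the local rings of the scheme);
* `isRegularLocalRing_stalk_of_smoothOfRelativeDimension_of_regular` — **for `f : X → Y` smooth of
  relative dimension `n` with `Y` locally noetherian and regular, every local ring `𝒪_{X,x}` is
  regular**: on charts `Γ(U) → Γ(U)[X₁, …, Xₙ] → Γ(V)` with the second map étale (Mathlib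
  `RingHom.IsStandardSmoothOfRelativeDimension.exists_etale_mvPolynomial`), polynomial rings over
  regular rings are regular (Mathlib `MvPolynomial.isRegularRing_of_isRegularRing`), and étale over
  regular local is regular local (`IsRegularLocalRing.of_etale` of this tree);
* `isRegularLocalRing_stalk_of_smoothOfRelativeDimension_specOfRegular` — the case `Y = Spec R`,
  `R` a regular ring (e.g. a discrete valuation ring), used for `P ×_K Spec R` with `P` smooth over
  the field `K`.

Everything is proved; no named facts. Mathlib searched (pin): `IsRegularRing`,
`isRegularRing_iff`, `IsRegularLocalRing.of_ringEquiv`, `IsRegularLocalRing.of_isRegularRing_of_isLocalRing`,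
`SmoothOfRelativeDimension.exists_isStandardSmoothOfRelativeDimension`,
`IsLocallyNoetherian.component_noetherian`, `IsAffineOpen.isLocalization_stalk`,
`StructureSheaf.IsLocalization.to_stalk` (used); in this tree `FieldNorm.fromSpec_mem`,
`FieldNorm.primeIdealOf_fromSpec` (`Motives/ProjectiveDescentNormProofs`).

## References

* The Stacks Project, Tag 036D (Descent, Lemma 35.15.?: smooth over regular is regular) and
  Tag 00TV. [StacksProject]
* U. Görtz, T. Wedhorn, *Algebraic Geometry I: Schemes*, 2nd ed. (2020): Lemma 6.26 (p. 196).
  [GortzWedhorn2020]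
* H. Matsumura, *Commutative Ring Theory*, CSAM 8 (1986): Thm. 23.7 (ii). [Matsumura1987]
-/

universe u

open CategoryTheory AlgebraicGeometry TopologicalSpace IsLocalRing

noncomputable section

namespace Literature.AlgebraicGeometry.Motives

/-! ### Affine opens of a regular locally noetherian scheme have regular rings of sections -/

section AffineOpen

variable {Y : Scheme.{u}} {U : Y.Opens} (hU : IsAffineOpen U)

include hU in
/-- **On a locally noetherian scheme all of whose local rings are regular, `Γ(U, 𝒪)` is a regular
ring for every affine open `U`** (its localisation at a prime `𝔮` is the local ring at the
corresponding point). [cite: StacksProject, Tag 036D] -/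
theorem isRegularRing_of_isAffineOpen [IsLocallyNoetherian Y]
    (hY : ∀ y : Y, IsRegularLocalRing (Y.presheaf.stalk y)) : IsRegularRing Γ(Y, U) := by
  haveI : IsNoetherianRing Γ(Y, U) := IsLocallyNoetherian.component_noetherian ⟨U, hU⟩
  rw [isRegularRing_iff]
  intro P hP
  let y : Y := hU.fromSpec ⟨P, hP⟩
  have hy : y ∈ U := FieldNorm.fromSpec_mem hU ⟨P, hP⟩
  letI : Algebra Γ(Y, U) (Y.presheaf.stalk y) :=
    TopCat.Presheaf.algebra_section_stalk Y.presheaf ⟨y, hy⟩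
  have hloc : IsLocalization.AtPrime (Y.presheaf.stalk y) (hU.primeIdealOf ⟨y, hy⟩).asIdeal :=
    hU.isLocalization_stalk ⟨y, hy⟩
  rw [FieldNorm.primeIdealOf_fromSpec hU ⟨P, hP⟩] at hloc
  haveI := hY y
  exact IsRegularLocalRing.of_ringEquiv
    (IsLocalization.algEquiv P.primeCompl (Y.presheaf.stalk y) (Localization.AtPrime P)).toRingEquiv

end AffineOpen

/-! ### Smooth over regular is regular -/

/-- **Görtz–Wedhorn I, Lemma 6.26 / Stacks 036D over a regular base**: for `f : X → Y` smooth of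
relative dimension `n` (Mathlib `SmoothOfRelativeDimension`), `Y` locally noetherian with regular
local rings, every local ring `𝒪_{X,x}` is a regular local ring. On charts `Γ(U) → Γ(V)` is standard
smooth of relative dimension `n`, hence `Γ(U) → Γ(U)[X₁, …, Xₙ] → Γ(V)` with the second map étale;
`Γ(U)[X₁, …, Xₙ]` is a regular ring, and étale over regular local is regular local.
[cite: StacksProject, Tag 036D] [cite: GortzWedhorn2020, Lemma 6.26 (p. 196)] -/
theorem isRegularLocalRing_stalk_of_smoothOfRelativeDimension_of_regular {X Y : Scheme.{u}}
    (f : X ⟶ Y) (n : ℕ) [SmoothOfRelativeDimension n f] [IsLocallyNoetherian Y]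
    (hY : ∀ y : Y, IsRegularLocalRing (Y.presheaf.stalk y)) (x : X) :
    IsRegularLocalRing (X.presheaf.stalk x) := by
  obtain ⟨U, hU, V, hV, hxV, e, hstd⟩ :=
    SmoothOfRelativeDimension.exists_isStandardSmoothOfRelativeDimension (n := n) (f := f) x
  haveI : IsRegularRing Γ(Y, U) := isRegularRing_of_isAffineOpen hU hY
  obtain ⟨g, hgC, hget⟩ := hstd.exists_etale_mvPolynomial
  algebraize [g]
  letI : Algebra Γ(X, V) (X.presheaf.stalk x) :=
    TopCat.Presheaf.algebra_section_stalk X.presheaf ⟨x, hxV⟩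
  have hloc : IsLocalization.AtPrime (X.presheaf.stalk x) (hV.primeIdealOf ⟨x, hxV⟩).asIdeal :=
    hV.isLocalization_stalk ⟨x, hxV⟩
  let P := (hV.primeIdealOf ⟨x, hxV⟩).asIdeal
  haveI : IsRegularLocalRing (Localization.AtPrime P) :=
    IsRegularLocalRing.of_etale (R := MvPolynomial (Fin n) Γ(Y, U)) P
  exact IsRegularLocalRing.of_ringEquiv
    (IsLocalization.algEquiv P.primeCompl (Localization.AtPrime P) (X.presheaf.stalk x)).toRingEquiv

/-- **A scheme smooth of relative dimension `n` over `Spec R`, `R` a regular ring (e.g. a discrete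
valuation ring or a field), has regular local rings** — the local rings of `Spec R` are the
localisations `R_𝔭`. [cite: StacksProject, Tag 036D] -/
theorem isRegularLocalRing_stalk_of_smoothOfRelativeDimension_specOfRegular {X : Scheme.{u}}
    {R : CommRingCat.{u}} [IsRegularRing R] (f : X ⟶ Spec R) (n : ℕ)
    [SmoothOfRelativeDimension n f] (x : X) : IsRegularLocalRing (X.presheaf.stalk x) := by
  haveI : IsLocallyNoetherian (Spec R) := inferInstance
  refine isRegularLocalRing_stalk_of_smoothOfRelativeDimension_of_regular f n (fun y => ?_) x
  letI : Algebra R ((Spec R).presheaf.stalk y) := StructureSheaf.stalkAlgebra R y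
  haveI : IsLocalization.AtPrime ((Spec R).presheaf.stalk y) y.asIdeal :=
    StructureSheaf.IsLocalization.to_stalk R y
  exact IsRegularLocalRing.of_ringEquiv
    (IsLocalization.algEquiv y.asIdeal.primeCompl (Localization.AtPrime y.asIdeal)
      ((Spec R).presheaf.stalk y)).toRingEquiv

end Literature.AlgebraicGeometry.Motives

end
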